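import Literature.AlgebraicGeometry.Motives.QuasiProjectiveOfGeneratingSections
import Literature.AlgebraicGeometry.Motives.VarietiesProperProofs
import HarnessLib

/-!
# Quasi-projective schemes over a field are separated, quasi-compact and of finite type; separatedness from generating
# sections with affine non-vanishing loci

Layer `Literature/AlgebraicGeometry/HodgeTheory`, namespace `Literature.AlgebraicGeometry.HodgeTheory` (+ one corollary in
`Literature.AlgebraicGeometry.Motives.GeneratingSections`).  THEOREMS ONLY (no definition, no named fact, no instance, no
notation; net Literature debt **0**).

The tree's quasi-projectivity over a field is ★ `HodgeTheory.IsQuasiProjectiveOver X` (`GlobalInvariantCycles` :69: an open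
`k`-immersion `j : X ↪ P` into a PROJECTIVE `k`-scheme `P`, ★ `Motives.IsProjectiveOver` = closed immersion into some
`ℙⁿ_k`, [Hartshorne1977] II §4 p. 103).  Its elementary consequences were so far recorded over `ℂ` only
(★ `IsQuasiProjectiveOver.isSeparated`, `RelativeHyperplaneClassHodgeRiemann` :90; ★ `IsQuasiProjectiveOver.locallyOfFiniteType`,
`MotivatedClassesDeformation` :554).  This file states them over an ARBITRARY field `k`, with the same five-line proofs
(`X → Spec k` is `j ≫ (P → Spec k)`, an open immersion followed by a proper morphism — ★ `Motives.IsProjectiveOver.isProper`,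
[Hartshorne1977] II Thm. 4.9):

* `IsQuasiProjectiveOver.hom_isSeparated`, `….hom_locallyOfFiniteType`, `….left_isLocallyNoetherian`,
  `….left_compactSpace` / `….hom_quasiCompact` (the open subscheme of the Noetherian `P` is quasi-compact) — dot-notation
  names on `h : IsQuasiProjectiveOver X`, universe-polymorphic (the tree's `ℂ`/`Type 0` lemmas `IsQuasiProjectiveOver.isSeparated`,
  `….locallyOfFiniteType`, `locallyOfFiniteType_of_isQuasiProjectiveOver` (`AlgebraicityLocus` :178, `K : Type`) are the special cases);
* **`Motives.GeneratingSections.isSeparated_of_isAffineOpen`** — a `k`-scheme locally of finite type carrying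
  generating-sections data `D : GeneratingSections ι Z` ([GortzWedhorn2020] Prop. 13.47: finitely many global sections of an
  invertible sheaf, generating it, with AFFINE non-vanishing loci `Z_{sᵢ}` — the chart form ★ `Motives.GeneratingSections`)
  is SEPARATED over `k`: it is quasi-projective by ★ `GeneratingSections.isQuasiProjectiveOver_of_isAffineOpen`
  ([GortzWedhorn2020] Prop. 13.47 (iv) ⇒ (i) with Thm. 13.59 / Summary 13.71 (1); [EGAII] Thm. 4.5.2), hence separated.
  This is the «ample-type cover ⇒ separated» step by which [MumfordFogartyKirwan1994] Ch. 3 Thm. 3.8 («`M₀ ⊗ ⋯ ⊗ M_m` is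
  ample on `Z₀`, hence `Z₀` is quasi-projective») yields the separatedness of the quotient in Ch. 7 (Thm. 7.9 p. 139) —
  the cell's F-DAG leaf F-8 (8d) / F-9 (9c) on the slice road, where `Z` is the glued moduli scheme `A⁰` over `ℚ` and the
  sections are the invariant determinants `D_α` (Def. 3.7 / Prop. 3.4–3.6 pp. 72–75).

Cell hodgecm-mathlib (D-0151), fan B, F-DAG capital (price pen B-p03 (g16) GO 2026-08-30T04:10:43Z, sheet v0.9/v1.0 §3 F-8
(8d) / F-9 (9c) «by name» line); typer seat B-typ02 (g14).  HC_CM is proved only modulo the 7 printed citations until rung 0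
closes; this file discharges none of them and adds no hypothesis to anything.

## References
* [Hartshorne1977] R. Hartshorne, *Algebraic Geometry* (1977), II §4 p. 103 (quasi-projective), Thm. 4.9 (p. 103) (projective
  ⇒ proper), Cor. 4.6 (p. 99) / Cor. 4.8 (p. 102) (open and closed immersions and compositions are separated / proper).
* [GortzWedhorn2020] U. Görtz, T. Wedhorn, *Algebraic Geometry I*, 2nd ed. (2020), Prop. 13.47 (pp. 392–393), Thm. 13.59
  (p. 398), Summary 13.71 (1) (p. 404).
* [EGAII] A. Grothendieck, J. Dieudonné, *EGA II* (1961), Thm. 4.5.2, Prop. 5.3.2.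
* [MumfordFogartyKirwan1994] D. Mumford, J. Fogarty, F. Kirwan, *Geometric Invariant Theory*, 3rd ed. (1994), Ch. 3 §2
  Thm. 3.8 (pp. 75–76), Ch. 7 §3 Thm. 7.9 (p. 139).
-/

set_option autoImplicit false

universe u

open CategoryTheory AlgebraicGeometry

noncomputable section

namespace Literature.AlgebraicGeometry.HodgeTheory

variable {k : Type u} [Field k] {X : Motives.SchemeOver k}

/-- **A quasi-projective `k`-scheme is separated over `k`** (any field `k`): `X → Spec k` is an open immersion `j` followed by
the structure morphism of a projective, hence proper ([Hartshorne1977] II Thm. 4.9, ★ `Motives.IsProjectiveOver.isProper`),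
hence separated, `k`-scheme.  The `ℂ`-case is ★ `IsQuasiProjectiveOver.isSeparated`.
[cite: Hartshorne1977, II Thm. 4.9 (p. 103) and Cor. 4.6 (p. 99)] -/
theorem IsQuasiProjectiveOver.hom_isSeparated (h : IsQuasiProjectiveOver X) : IsSeparated X.hom := by
  obtain ⟨P, j, hP, hj⟩ := h
  haveI := hj
  haveI : IsProper P.hom := hP.isProper
  rw [← Over.w j]
  infer_instance

/-- **A quasi-projective `k`-scheme is locally of finite type over `k`** (any field `k`; same proof; the `ℂ`-case is ★
`IsQuasiProjectiveOver.locallyOfFiniteType`). [cite: Hartshorne1977, II Thm. 4.9 (p. 103)] -/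
theorem IsQuasiProjectiveOver.hom_locallyOfFiniteType (h : IsQuasiProjectiveOver X) :
    LocallyOfFiniteType X.hom := by
  obtain ⟨P, j, hP, hj⟩ := h
  haveI := hj
  haveI : IsProper P.hom := hP.isProper
  rw [← Over.w j]
  infer_instance

/-- **A quasi-projective `k`-scheme is locally Noetherian** (an open subscheme of a scheme of finite type over a field).
[cite: Hartshorne1977, II Thm. 4.9 (p. 103)] -/
theorem IsQuasiProjectiveOver.left_isLocallyNoetherian (h : IsQuasiProjectiveOver X) :
    IsLocallyNoetherian X.left := by
  haveI := h.hom_locallyOfFiniteType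
  exact LocallyOfFiniteType.isLocallyNoetherian X.hom

/-- **The underlying space of a quasi-projective `k`-scheme is quasi-compact**: an open subspace of the Noetherian
space underlying a projective `k`-scheme (of finite type over a field). [cite: Hartshorne1977, II Thm. 4.9 (p. 103)] -/
theorem IsQuasiProjectiveOver.left_compactSpace (h : IsQuasiProjectiveOver X) : CompactSpace X.left := by
  obtain ⟨P, j, hP, hj⟩ := h
  haveI := hj
  haveI : IsProper P.hom := hP.isProper
  haveI : IsLocallyNoetherian P.left := LocallyOfFiniteType.isLocallyNoetherian P.hom
  haveI : CompactSpace P.left :=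
    (HasAffineProperty.iff_of_isAffine (P := @QuasiCompact) (f := P.hom)).mp inferInstance
  haveI : IsNoetherian P.left := ⟨⟩
  have hc : IsCompact (Set.range j.left.base) := TopologicalSpace.NoetherianSpace.isCompact _
  refine ⟨?_⟩
  rw [← Set.image_univ] at hc
  exact (j.left.isOpenEmbedding.isCompact_iff (s := Set.univ)).mpr hc

/-- **A quasi-projective `k`-scheme is quasi-compact over `k`** (hence of finite type): it is an open subscheme of a
projective `k`-scheme, which is of finite type over `k` and therefore Noetherian, and open subsets of Noetherian spaces
are quasi-compact. [cite: Hartshorne1977, II Thm. 4.9 (p. 103)] -/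
theorem IsQuasiProjectiveOver.hom_quasiCompact (h : IsQuasiProjectiveOver X) : QuasiCompact X.hom :=
  haveI := h.left_compactSpace
  (HasAffineProperty.iff_of_isAffine (P := @QuasiCompact) (f := X.hom)).mpr ‹CompactSpace X.left›

end Literature.AlgebraicGeometry.HodgeTheory

namespace Literature.AlgebraicGeometry.Motives

namespace GeneratingSections

open Literature.AlgebraicGeometry.HodgeTheory

variable {ι : Type} {k : Type u} [Field k] {Z : SchemeOver k} [Finite ι] (D : GeneratingSections ι Z.left)

/-- **Generating sections with affine non-vanishing loci ⇒ SEPARATED** (over any field `k`): a `k`-scheme locally of finite type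
carrying generating-sections data `D` with finitely many charts `U i = Z_{sᵢ}`, all AFFINE, is separated over `k` — it is
quasi-projective (★ `isQuasiProjectiveOver_of_isAffineOpen`: the invertible sheaf is ample, [GortzWedhorn2020] Prop. 13.47
(iv) ⇒ (i), Thm. 13.59) and quasi-projective schemes are separated (`IsQuasiProjectiveOver.hom_isSeparated`).  The step
«ample line bundle with affine non-vanishing loci covering ⇒ quasi-projective ⇒ separated» of [MumfordFogartyKirwan1994]
Thm. 3.8 / Thm. 7.9. [cite: GortzWedhorn2020, Prop. 13.47 (pp. 392–393) and Thm. 13.59 (p. 398)]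
[cite: MumfordFogartyKirwan1994, Ch. 3 §2 Theorem 3.8 (pp. 75–76) and Ch. 7 §3 Theorem 7.9 (p. 139)] -/
theorem isSeparated_of_isAffineOpen [LocallyOfFiniteType Z.hom] (hU : ∀ i, IsAffineOpen (D.U i)) :
    IsSeparated Z.hom :=
  (D.isQuasiProjectiveOver_of_isAffineOpen hU).hom_isSeparated

/-- … and QUASI-COMPACT over `k` (so of finite type). [cite: GortzWedhorn2020, Prop. 13.47 (pp. 392–393) and Thm. 13.59 (p. 398)] -/
theorem quasiCompact_of_isAffineOpen [LocallyOfFiniteType Z.hom] (hU : ∀ i, IsAffineOpen (D.U i)) :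
    QuasiCompact Z.hom :=
  (D.isQuasiProjectiveOver_of_isAffineOpen hU).hom_quasiCompact

end GeneratingSections

end Literature.AlgebraicGeometry.Motives

end
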